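import Mathlib
import Summits.ValiantsHypothesis.ValiantsHypothesis.Theses.ValuativeGCT
import Summits.ValiantsHypothesis.ValiantsHypothesis.Theorems.CutBites.Negative.NoCutInOddDegree
import Summits.ValiantsHypothesis.ValiantsHypothesis.Theorems.CutBites.Negative.NoCutForColumnCompression
import Summits.ValiantsHypothesis.ValiantsHypothesis.Theorems.CutBites.Negative.NonVacuity

/-!
# `CutBites` — negative lemma: PARITY OF THE NORMAL ORDER (`T 2 = T 1` in even degree)

Crux `stmt-ValiantsHypothesis-12626` (`Theses.ValuativeGCT.CutBites`, route ValuativeGCT).  Standing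
disprover (cdisprove gen 3), `Cruxes/CutBites/Disproof.lean` §G, restated over the crux's literal
`let`-blocks so that planners / provers can import it.  Companion of `NoCutInOddDegree` (§C: in ODD
degree `T 1 = T 0`); the first-rung consequences are in `NoCutAtSecondStep`.

Split every row into skew and symmetric parts, `A = S + N`.  The transposition matrix `M_τ` lies in the
`End`-stabiliser of `det_m` (`linSubst_swapMatrix_detFormLex`) and gives, for an invariant form `G` of
degree `D`, `G(S + N) = G(-S + N) = (-1)^D G(S - N)`: `G` is EVEN in the normal directions when `D` is
even, so its order of vanishing along `L_Λ = {N = 0}` is even.  The half needing no description of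
`P_Λ^t` beyond `(n-coordinates)² ⊆ P_Λ²`:

* `mem_vanishingIdeal_sq_of_even_of_rowTranspose_invariant` — an `M_τ`-invariant form of EVEN degree
  vanishing on `L_Λ` lies in `P_Λ²` (skew/symmetric coordinates; the restriction to `N = 0` vanishes
  by `MvPolynomial.funext`, the odd `N`-degrees vanish by `M_τ`).
* `cutBites_trunc_two_eq_trunc_one_of_even` — hence the crux's truncation has `T 2 = T 1` for every
  `m`, every `δ` with `m δ` even, every `λ`; in particular at the FIRST RUNG `δ = 2` for every `m`
  (`cutBites_trunc_firstRung_two_eq_one`): the threshold `t = δ = 2` is immaterial there.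
[folklore]
-/

namespace Summit.ValiantsHypothesis.ValiantsHypothesis.Theorems.CutBites.Negative

open Literature.NumberTheory.DiophantineGeometry Literature.Computability.AlgebraicComplexity
open MvPolynomial
open scoped BigOperators Matrix

noncomputable section

/-- **Parity of the normal order (even degree).**  A form of even degree `D` on `End(ℂ^{m×m})`,
invariant under `A ↦ A M_τ` (transpose every row; the crux's stabiliser clause at `M = M_τ`) and
vanishing at every point all of whose rows are skew, lies in the SQUARE of the vanishing ideal of
those points. [folklore] -/
theorem mem_vanishingIdeal_sq_of_even_of_rowTranspose_invariant {m D : ℕ} (hD : Even D)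
    {G : MvPolynomial (MatIdx m × MatIdx m) ℂ} (hGh : G.IsHomogeneous D)
    (hGs : MvPolynomial.aeval (R := ℂ) (fun p : MatIdx m × MatIdx m =>
      ∑ l : MatIdx m, (Matrix.of fun l i : MatIdx m =>
        if l = toLex ((ofLex i).2, (ofLex i).1) then (1 : ℂ) else 0) l p.2 • MvPolynomial.X (p.1, l)) G = G)
    (hGv : G ∈ MvPolynomial.vanishingIdeal ℂ {p : MatIdx m × MatIdx m → ℂ |
      ∀ j : MatIdx m, (fun i => p (j, i)) ∈ Submodule.span ℂ
        {u : MatIdx m → ℂ | ∀ a b : Fin m, u (toLex (a, b)) = -u (toLex (b, a))}}) :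
    G ∈ (MvPolynomial.vanishingIdeal ℂ {p : MatIdx m × MatIdx m → ℂ |
      ∀ j : MatIdx m, (fun i => p (j, i)) ∈ Submodule.span ℂ
        {u : MatIdx m → ℂ | ∀ a b : Fin m, u (toLex (a, b)) = -u (toLex (b, a))}}) ^ 2 := by
  -- the locus, its ideal, the row transposition
  set L : Set (MatIdx m × MatIdx m → ℂ) := {p : MatIdx m × MatIdx m → ℂ |
      ∀ j : MatIdx m, (fun i => p (j, i)) ∈ Submodule.span ℂ
        {u : MatIdx m → ℂ | ∀ a b : Fin m, u (toLex (a, b)) = -u (toLex (b, a))}} with hL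
  set P : Ideal (MvPolynomial (MatIdx m × MatIdx m) ℂ) := MvPolynomial.vanishingIdeal ℂ L with hP
  have hxsk : ∀ x ∈ L, ∀ (j : MatIdx m) (a b : Fin m), x (j, toLex (a, b)) = -x (j, toLex (b, a)) :=
    fun x hx j a b => skew_of_mem_span_skew (hx j) a b
  set sw : MatIdx m × MatIdx m → MatIdx m × MatIdx m :=
    fun p => (p.1, toLex ((ofLex p.2).2, (ofLex p.2).1)) with hsw
  have sw_sw : ∀ p, sw (sw p) = p := fun p => rfl
  have sw_eq : ∀ p : MatIdx m × MatIdx m, (ofLex p.2).1 = (ofLex p.2).2 → sw p = p := by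
    rintro ⟨j, i⟩ h
    change (ofLex i).1 = (ofLex i).2 at h
    show (j, toLex ((ofLex i).2, (ofLex i).1)) = (j, i)
    rw [← h]
    exact congrArg (fun q : Fin m × Fin m => (j, toLex q)) (Prod.ext rfl h)
  have hGs' : rename sw G = G := by
    have hre : (MvPolynomial.aeval (R := ℂ) fun p : MatIdx m × MatIdx m =>
        ∑ l : MatIdx m, (Matrix.of fun l i : MatIdx m =>
          if l = toLex ((ofLex i).2, (ofLex i).1) then (1 : ℂ) else 0) l p.2 • MvPolynomial.X (p.1, l))
        = rename sw := by
      refine MvPolynomial.algHom_ext fun p => ?_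
      rw [aeval_X, rename_X]
      exact sum_swapMatrix_smul (fun l => (X (p.1, l) : MvPolynomial (MatIdx m × MatIdx m) ℂ)) p.2
    rw [hre] at hGs
    exact hGs
  -- skew/symmetric coordinates: old in terms of new (`κ`), new in terms of old (`θ`), the normal
  -- reflection (`ν`), the restriction to `N = 0` (`ζ`) and its reading in old coordinates (`π`)
  set κ : MatIdx m × MatIdx m → MvPolynomial (MatIdx m × MatIdx m) ℂ := fun p =>
    if (ofLex p.2).1 < (ofLex p.2).2 then C (2⁻¹ : ℂ) * (X p + X (sw p))
    else if (ofLex p.2).2 < (ofLex p.2).1 then C (2⁻¹ : ℂ) * (X p - X (sw p)) else X p with hκ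
  set θ : MatIdx m × MatIdx m → MvPolynomial (MatIdx m × MatIdx m) ℂ := fun p =>
    if (ofLex p.2).1 < (ofLex p.2).2 then X p - X (sw p)
    else if (ofLex p.2).2 < (ofLex p.2).1 then X p + X (sw p) else X p with hθ
  set ν : MatIdx m × MatIdx m → ℂ := fun p => if (ofLex p.2).1 < (ofLex p.2).2 then 1 else -1 with hν
  set ζ : MatIdx m × MatIdx m → ℂ := fun p => if (ofLex p.2).1 < (ofLex p.2).2 then 1 else 0 with hζ
  set π : MatIdx m × MatIdx m → MvPolynomial (MatIdx m × MatIdx m) ℂ := fun p =>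
    if (ofLex p.2).1 < (ofLex p.2).2 then C (2⁻¹ : ℂ) * X p
    else if (ofLex p.2).2 < (ofLex p.2).1 then -(C (2⁻¹ : ℂ) * X (sw p)) else 0 with hπ
  have κ_lt : ∀ p, (ofLex p.2).1 < (ofLex p.2).2 → κ p = C (2⁻¹ : ℂ) * (X p + X (sw p)) :=
    fun p h => by simp only [hκ, if_pos h]
  have κ_gt : ∀ p, (ofLex p.2).2 < (ofLex p.2).1 → κ p = C (2⁻¹ : ℂ) * (X p - X (sw p)) :=
    fun p h => by simp only [hκ, if_neg (not_lt_of_gt h), if_pos h]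
  have κ_eq : ∀ p, (ofLex p.2).1 = (ofLex p.2).2 → κ p = X p :=
    fun p h => by simp only [hκ, h, lt_self_iff_false, if_false]
  have θ_lt : ∀ p, (ofLex p.2).1 < (ofLex p.2).2 → θ p = X p - X (sw p) :=
    fun p h => by simp only [hθ, if_pos h]
  have θ_gt : ∀ p, (ofLex p.2).2 < (ofLex p.2).1 → θ p = X p + X (sw p) :=
    fun p h => by simp only [hθ, if_neg (not_lt_of_gt h), if_pos h]
  have θ_eq : ∀ p, (ofLex p.2).1 = (ofLex p.2).2 → θ p = X p :=
    fun p h => by simp only [hθ, h, lt_self_iff_false, if_false]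
  have π_lt : ∀ p, (ofLex p.2).1 < (ofLex p.2).2 → π p = C (2⁻¹ : ℂ) * X p :=
    fun p h => by simp only [hπ, if_pos h]
  have π_gt : ∀ p, (ofLex p.2).2 < (ofLex p.2).1 → π p = -(C (2⁻¹ : ℂ) * X (sw p)) :=
    fun p h => by simp only [hπ, if_neg (not_lt_of_gt h), if_pos h]
  have π_eq : ∀ p, (ofLex p.2).1 = (ofLex p.2).2 → π p = 0 :=
    fun p h => by simp only [hπ, h, lt_self_iff_false, if_false]
  have ν_lt : ∀ p, (ofLex p.2).1 < (ofLex p.2).2 → ν p = 1 := fun p h => by simp only [hν, if_pos h]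
  have ν_nlt : ∀ p, ¬ (ofLex p.2).1 < (ofLex p.2).2 → ν p = -1 := fun p h => by simp only [hν, if_neg h]
  have ζ_lt : ∀ p, (ofLex p.2).1 < (ofLex p.2).2 → ζ p = 1 := fun p h => by simp only [hζ, if_pos h]
  have ζ_nlt : ∀ p, ¬ (ofLex p.2).1 < (ofLex p.2).2 → ζ p = 0 := fun p h => by simp only [hζ, if_neg h]
  have h2 : C (2⁻¹ : ℂ) * 2 = (1 : MvPolynomial (MatIdx m × MatIdx m) ℂ) := by
    rw [← map_ofNat C 2, ← map_mul, inv_mul_cancel₀ two_ne_zero, map_one]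
  -- (1) `θ ∘ κ = id`
  have θκ : ∀ p, MvPolynomial.aeval (R := ℂ) θ (κ p) = X p := by
    intro p
    rcases lt_trichotomy (ofLex p.2).1 (ofLex p.2).2 with h | h | h
    · rw [κ_lt p h, map_mul, aeval_C, algebraMap_eq, map_add, aeval_X, aeval_X, θ_lt p h,
        θ_gt (sw p) h, sw_sw]
      linear_combination (X p) * h2
    · rw [κ_eq p h, aeval_X, θ_eq p h]
    · rw [κ_gt p h, map_mul, aeval_C, algebraMap_eq, map_sub, aeval_X, aeval_X, θ_gt p h,
        θ_lt (sw p) h, sw_sw]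
      linear_combination (X p) * h2
  have θκG : MvPolynomial.aeval (R := ℂ) θ (MvPolynomial.aeval (R := ℂ) κ G) = G := by
    have hc : (MvPolynomial.aeval (R := ℂ) θ).comp (MvPolynomial.aeval (R := ℂ) κ)
        = AlgHom.id ℂ (MvPolynomial (MatIdx m × MatIdx m) ℂ) :=
      MvPolynomial.algHom_ext fun p => by rw [AlgHom.comp_apply, aeval_X, θκ, AlgHom.id_apply]
    simpa using AlgHom.congr_fun hc G
  -- (2) the normal reflection in new coordinates = "negate and transpose every row" in old ones
  have νκ : ∀ p, MvPolynomial.aeval (R := ℂ) (fun q => ν q • (X q : MvPolynomial (MatIdx m × MatIdx m) ℂ)) (κ p)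
      = MvPolynomial.aeval (R := ℂ) κ ((-1 : ℂ) • (X (sw p) : MvPolynomial (MatIdx m × MatIdx m) ℂ)) := by
    intro p
    rcases lt_trichotomy (ofLex p.2).1 (ofLex p.2).2 with h | h | h
    · rw [κ_lt p h]
      simp only [map_mul, map_add, aeval_C, algebraMap_eq, aeval_X, smul_eq_C_mul]
      rw [ν_lt p h, ν_nlt (sw p) (not_lt_of_gt h), κ_gt (sw p) h, sw_sw]
      simp only [map_one, map_neg]
      ring
    · rw [κ_eq p h]
      simp only [aeval_X, smul_eq_C_mul, map_mul, aeval_C, algebraMap_eq]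
      rw [ν_nlt p (by rw [h]; exact lt_irrefl _), sw_eq p h, κ_eq p h]
    · rw [κ_gt p h]
      simp only [map_mul, map_sub, aeval_C, algebraMap_eq, aeval_X, smul_eq_C_mul]
      rw [ν_nlt p (not_lt_of_gt h), ν_lt (sw p) h, κ_lt (sw p) h, sw_sw]
      simp only [map_one, map_neg]
      ring
  -- (3) the restriction to `N = 0` in new coordinates = the generic-skew substitution in old ones
  have ζκ : ∀ p, MvPolynomial.aeval (R := ℂ) (fun q => ζ q • (X q : MvPolynomial (MatIdx m × MatIdx m) ℂ)) (κ p)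
      = π p := by
    intro p
    rcases lt_trichotomy (ofLex p.2).1 (ofLex p.2).2 with h | h | h
    · rw [κ_lt p h]
      simp only [map_mul, map_add, aeval_C, algebraMap_eq, aeval_X]
      rw [ζ_lt p h, ζ_nlt (sw p) (not_lt_of_gt h), π_lt p h]
      simp only [one_smul, zero_smul, add_zero]
    · rw [κ_eq p h, aeval_X, ζ_nlt p (by rw [h]; exact lt_irrefl _), π_eq p h, zero_smul]
    · rw [κ_gt p h]
      simp only [map_mul, map_sub, aeval_C, algebraMap_eq, aeval_X]
      rw [ζ_nlt p (not_lt_of_gt h), ζ_lt (sw p) h, π_gt p h]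
      simp only [one_smul, zero_smul, zero_sub, mul_neg]
  -- every value of the generic-skew substitution is a point of `L`
  have πL : ∀ x : MatIdx m × MatIdx m → ℂ, (fun p => MvPolynomial.eval x (π p)) ∈ L := by
    intro x j
    refine Submodule.subset_span fun a b => ?_
    rcases lt_trichotomy a b with h | h | h
    · have h1 : (ofLex ((j, toLex (a, b)) : MatIdx m × MatIdx m).2).1
          < (ofLex ((j, toLex (a, b)) : MatIdx m × MatIdx m).2).2 := h
      have h2 : (ofLex ((j, toLex (b, a)) : MatIdx m × MatIdx m).2).2
          < (ofLex ((j, toLex (b, a)) : MatIdx m × MatIdx m).2).1 := h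
      simp only [π_lt _ h1, π_gt _ h2, map_neg, map_mul, eval_C, eval_X, neg_neg]
      rfl
    · subst h
      have h1 : (ofLex ((j, toLex (a, a)) : MatIdx m × MatIdx m).2).1
          = (ofLex ((j, toLex (a, a)) : MatIdx m × MatIdx m).2).2 := rfl
      simp only [π_eq _ h1, map_zero, neg_zero]
    · have h1 : (ofLex ((j, toLex (a, b)) : MatIdx m × MatIdx m).2).2
          < (ofLex ((j, toLex (a, b)) : MatIdx m × MatIdx m).2).1 := h
      have h2 : (ofLex ((j, toLex (b, a)) : MatIdx m × MatIdx m).2).1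
          < (ofLex ((j, toLex (b, a)) : MatIdx m × MatIdx m).2).2 := h
      simp only [π_gt _ h1, π_lt _ h2, map_neg, map_mul, eval_C, eval_X]
      rfl
  -- a form vanishing on `L` dies under the generic-skew substitution
  have πG : MvPolynomial.aeval (R := ℂ) π G = 0 := by
    refine MvPolynomial.funext fun x => ?_
    rw [map_zero]
    have hcomp := AlgHom.congr_fun (MvPolynomial.comp_aeval π (MvPolynomial.aeval (R := ℂ) x)) G
    rw [AlgHom.comp_apply] at hcomp
    have hG0 := hGv
    rw [mem_vanishingIdeal_iff] at hG0
    have key : MvPolynomial.aeval (R := ℂ) x (MvPolynomial.aeval (R := ℂ) π G) = 0 :=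
      hcomp.trans (hG0 _ (πL x))
    simpa [MvPolynomial.coe_aeval_eq_eval] using key
  -- the two products of signs over an exponent vector, in terms of its `N`-degree
  have prod_ν : ∀ α : MatIdx m × MatIdx m →₀ ℕ, ∏ p ∈ α.support, ν p ^ α p
      = (-1) ^ (∑ p ∈ α.support with ¬ (ofLex p.2).1 < (ofLex p.2).2, α p) := by
    intro α
    rw [← Finset.prod_filter_mul_prod_filter_not α.support (fun p => (ofLex p.2).1 < (ofLex p.2).2),
      Finset.prod_eq_one (fun p hp => by rw [ν_lt p (Finset.mem_filter.mp hp).2, one_pow]),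
      one_mul, ← Finset.prod_pow_eq_pow_sum]
    exact Finset.prod_congr rfl fun p hp => by rw [ν_nlt p (Finset.mem_filter.mp hp).2]
  have prod_ζ : ∀ α : MatIdx m × MatIdx m →₀ ℕ, ∏ p ∈ α.support, ζ p ^ α p
      = if (∑ p ∈ α.support with ¬ (ofLex p.2).1 < (ofLex p.2).2, α p) = 0 then 1 else 0 := by
    intro α
    rw [← Finset.prod_filter_mul_prod_filter_not α.support (fun p => (ofLex p.2).1 < (ofLex p.2).2),
      Finset.prod_eq_one (fun p hp => by rw [ζ_lt p (Finset.mem_filter.mp hp).2, one_pow]),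
      one_mul]
    by_cases h0 : (∑ p ∈ α.support with ¬ (ofLex p.2).1 < (ofLex p.2).2, α p) = 0
    · rw [if_pos h0]
      refine Finset.prod_eq_one fun p hp => ?_
      exfalso
      have hmem := Finset.mem_filter.mp hp
      have hpos : 0 < α p := Nat.pos_of_ne_zero (Finsupp.mem_support_iff.mp hmem.1)
      have hle : α p ≤ ∑ p ∈ α.support with ¬ (ofLex p.2).1 < (ofLex p.2).2, α p :=
        Finset.single_le_sum (f := fun p => α p) (fun _ _ => Nat.zero_le _) hp
      omega
    · rw [if_neg h0]
      obtain ⟨p, hp, hαp⟩ := Finset.exists_ne_zero_of_sum_ne_zero h0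
      exact Finset.prod_eq_zero hp (by rw [ζ_nlt p (Finset.mem_filter.mp hp).2, zero_pow hαp])
  -- the `n`-coordinates, read in old coordinates, vanish on `L`
  have θP : ∀ p : MatIdx m × MatIdx m, ¬ (ofLex p.2).1 < (ofLex p.2).2 → θ p ∈ P := by
    rintro ⟨j, i⟩ hp
    rw [hP, mem_vanishingIdeal_iff]
    intro x hx
    have hsk := hxsk x hx j (ofLex i).1 (ofLex i).2
    have hi : toLex ((ofLex i).1, (ofLex i).2) = i := rfl
    rw [hi] at hsk
    rcases (not_lt.mp hp).lt_or_eq with h | h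
    · have h' : (ofLex ((j, i) : MatIdx m × MatIdx m).2).2 < (ofLex ((j, i) : MatIdx m × MatIdx m).2).1 := h
      rw [θ_gt _ h', map_add, aeval_X, aeval_X]
      change x (j, i) + x (j, toLex ((ofLex i).2, (ofLex i).1)) = 0
      rw [hsk]
      ring
    · have h' : (ofLex ((j, i) : MatIdx m × MatIdx m).2).1 = (ofLex ((j, i) : MatIdx m × MatIdx m).2).2 :=
        h.symm
      rw [θ_eq _ h', aeval_X]
      change x (j, i) = 0
      have hii : toLex ((ofLex i).2, (ofLex i).1) = i := congrArg Prod.snd (sw_eq (j, i) h')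
      rw [hii] at hsk
      linear_combination hsk / 2
  -- THE ARGUMENT.  `G' :=` `G` in new coordinates.
  set G' := MvPolynomial.aeval (R := ℂ) κ G with hG'
  -- (a) `G'` is even in the normal coordinates
  have ha : MvPolynomial.aeval (R := ℂ) (fun q => ν q • (X q : MvPolynomial (MatIdx m × MatIdx m) ℂ)) G'
      = G' := by
    have hc : (MvPolynomial.aeval (R := ℂ)
          (fun q => ν q • (X q : MvPolynomial (MatIdx m × MatIdx m) ℂ))).comp (MvPolynomial.aeval (R := ℂ) κ)
        = (MvPolynomial.aeval (R := ℂ) κ).comp (MvPolynomial.aeval (R := ℂ) fun p =>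
            (-1 : ℂ) • (X (sw p) : MvPolynomial (MatIdx m × MatIdx m) ℂ)) :=
      MvPolynomial.algHom_ext fun p => by rw [AlgHom.comp_apply, AlgHom.comp_apply, aeval_X, aeval_X, νκ]
    have h := AlgHom.congr_fun hc G
    rw [AlgHom.comp_apply, AlgHom.comp_apply] at h
    rw [hG', h, aeval_smul_X_of_isHomogeneous hGh (-1) sw, hD.neg_one_pow, map_one, one_mul, hGs']
  -- (b) `G'` restricted to `N = 0` vanishes
  have hb : MvPolynomial.aeval (R := ℂ) (fun q => ζ q • (X q : MvPolynomial (MatIdx m × MatIdx m) ℂ)) G'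
      = 0 := by
    have hc : (MvPolynomial.aeval (R := ℂ)
          (fun q => ζ q • (X q : MvPolynomial (MatIdx m × MatIdx m) ℂ))).comp (MvPolynomial.aeval (R := ℂ) κ)
        = MvPolynomial.aeval (R := ℂ) π :=
      MvPolynomial.algHom_ext fun p => by rw [AlgHom.comp_apply, aeval_X, aeval_X, ζκ]
    have h := AlgHom.congr_fun hc G
    rw [AlgHom.comp_apply] at h
    rw [hG', h]
    exact πG
  -- (c) every monomial of `G'` has `N`-degree `≥ 2`
  have hcdeg : ∀ α ∈ G'.support, 2 ≤ ∑ p ∈ α.support with ¬ (ofLex p.2).1 < (ofLex p.2).2, α p := by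
    intro α hα
    have hne : coeff α G' ≠ 0 := mem_support_iff.mp hα
    have h1 := congrArg (coeff α) ha
    rw [coeff_aeval_smul_X, prod_ν] at h1
    have h3 := congrArg (coeff α) hb
    rw [coeff_aeval_smul_X, prod_ζ, coeff_zero] at h3
    have hn0 : (∑ p ∈ α.support with ¬ (ofLex p.2).1 < (ofLex p.2).2, α p) ≠ 0 := by
      intro h0
      rw [if_pos h0, one_mul] at h3
      exact hne h3
    have hev : Even (∑ p ∈ α.support with ¬ (ofLex p.2).1 < (ofLex p.2).2, α p) := by
      by_contra hodd
      rw [Nat.not_even_iff_odd] at hodd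
      rw [hodd.neg_one_pow, neg_one_mul] at h1
      exact hne (by linear_combination -(h1 / 2))
    obtain ⟨k, hk⟩ := hev
    omega
  -- (d) back to old coordinates: the `N`-part of every monomial lies in `P²`
  rw [← θκG, G'.as_sum, map_sum]
  refine Ideal.sum_mem _ fun α hα => ?_
  rw [aeval_monomial, Finsupp.prod,
    ← Finset.prod_filter_mul_prod_filter_not α.support (fun p => (ofLex p.2).1 < (ofLex p.2).2)]
  refine Ideal.mul_mem_left _ _ (Ideal.mul_mem_left _ _ ?_)
  refine Ideal.pow_le_pow_right (hcdeg α hα) ?_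
  rw [← Finset.prod_pow_eq_pow_sum]
  exact Ideal.prod_mem_prod fun p hp => Ideal.pow_mem_pow (θP p (Finset.mem_filter.mp hp).2) _

/-- Lattice bookkeeping: if every element of `Hom ⊓ S` lying in `P` lies in `P²`, thresholds `2` and
`1` agree. [folklore] -/
theorem inf_pow_two_eq_inf_pow_one {σ : Type*} (Hom S W : Submodule ℂ (MvPolynomial σ ℂ))
    (P : Ideal (MvPolynomial σ ℂ)) (h : ∀ G ∈ Hom, G ∈ S → G ∈ P → G ∈ P ^ 2) :
    Hom ⊓ (P ^ 2).restrictScalars ℂ ⊓ S ⊓ W = Hom ⊓ (P ^ 1).restrictScalars ℂ ⊓ S ⊓ W := by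
  ext G
  simp only [Submodule.mem_inf, pow_one, Submodule.restrictScalars_mem]
  constructor
  · rintro ⟨⟨⟨hH, hP⟩, hS⟩, hW⟩
    exact ⟨⟨⟨hH, (Ideal.pow_le_self two_ne_zero) hP⟩, hS⟩, hW⟩
  · rintro ⟨⟨⟨hH, hP⟩, hS⟩, hW⟩
    exact ⟨⟨⟨hH, h G hH hS hP⟩, hS⟩, hW⟩

/-- **`T 2 = T 1` in even degree.**  For every `m`, every `δ` with `m δ` even and every `λ ⊢ m δ`,
the crux's truncation (its `let`-blocks verbatim) has `T 2 = T 1`. [folklore] -/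
theorem cutBites_trunc_two_eq_trunc_one_of_even (m δ : ℕ) (heven : Even (m * δ))
    (lam : Nat.Partition (m * δ)) :
    (let U : Submodule ℂ (MatIdx m → ℂ) :=
        Submodule.span ℂ {u : MatIdx m → ℂ | ∀ a b : Fin m, u (toLex (a, b)) = -u (toLex (b, a))};
      let χ : Weight (MatIdx m) := (Weight.dualOfPartition (m * m) lam).toMatIdx;
      let T : ℕ → Submodule ℂ (MvPolynomial (MatIdx m × MatIdx m) ℂ) := fun t =>
        MvPolynomial.homogeneousSubmodule (MatIdx m × MatIdx m) ℂ (m * δ)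
        ⊓ ((MvPolynomial.vanishingIdeal ℂ {p : MatIdx m × MatIdx m → ℂ |
              ∀ j : MatIdx m, (fun i => p (j, i)) ∈ U}) ^ (t)).restrictScalars ℂ
        ⊓ (⨅ (M : Matrix (MatIdx m) (MatIdx m) ℂ)
            (_ : linSubst (MatIdx m) ℂ M (detFormLex ℂ m) = detFormLex ℂ m),
            LinearMap.ker ((MvPolynomial.aeval (R := ℂ) fun p : MatIdx m × MatIdx m =>
              ∑ l : MatIdx m, M l p.2 • MvPolynomial.X (p.1, l)).toLinearMap
              - LinearMap.id (R := ℂ) (M := MvPolynomial (MatIdx m × MatIdx m) ℂ)))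
        ⊓ (⨅ (g : Matrix.GeneralLinearGroup (MatIdx m) ℂ) (_ : IsUpperTriangular g),
            LinearMap.ker ((MvPolynomial.aeval (R := ℂ) fun p : MatIdx m × MatIdx m =>
              ∑ l : MatIdx m, ((g⁻¹ : Matrix.GeneralLinearGroup (MatIdx m) ℂ) :
                Matrix (MatIdx m) (MatIdx m) ℂ) p.1 l • MvPolynomial.X (l, p.2)).toLinearMap
              - weightChar χ g • LinearMap.id (R := ℂ) (M := MvPolynomial (MatIdx m × MatIdx m) ℂ)));
      T 2 = T 1) := by
  intro U χ T
  refine inf_pow_two_eq_inf_pow_one _ _ _ _ fun G hGh hGs hGP => ?_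
  have hGs' := (Submodule.mem_iInf _).mp ((Submodule.mem_iInf _).mp hGs
    (Matrix.of fun l i : MatIdx m => if l = toLex ((ofLex i).2, (ofLex i).1) then (1 : ℂ) else 0))
    (linSubst_swapMatrix_detFormLex m)
  rw [LinearMap.mem_ker, LinearMap.sub_apply, sub_eq_zero] at hGs'
  exact mem_vanishingIdeal_sq_of_even_of_rowTranspose_invariant heven
    ((mem_homogeneousSubmodule _ _).mp hGh) hGs' hGP

/-- **First rung.**  At `δ = 2` (degree `2m`, even for EVERY `m`) the crux's truncation has
`T 2 = T 1` for every weight. [folklore] -/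
theorem cutBites_trunc_firstRung_two_eq_one (m : ℕ) (lam : Nat.Partition (m * 2)) :
    (let U : Submodule ℂ (MatIdx m → ℂ) :=
        Submodule.span ℂ {u : MatIdx m → ℂ | ∀ a b : Fin m, u (toLex (a, b)) = -u (toLex (b, a))};
      let χ : Weight (MatIdx m) := (Weight.dualOfPartition (m * m) lam).toMatIdx;
      let T : ℕ → Submodule ℂ (MvPolynomial (MatIdx m × MatIdx m) ℂ) := fun t =>
        MvPolynomial.homogeneousSubmodule (MatIdx m × MatIdx m) ℂ (m * 2)
        ⊓ ((MvPolynomial.vanishingIdeal ℂ {p : MatIdx m × MatIdx m → ℂ |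
              ∀ j : MatIdx m, (fun i => p (j, i)) ∈ U}) ^ (t)).restrictScalars ℂ
        ⊓ (⨅ (M : Matrix (MatIdx m) (MatIdx m) ℂ)
            (_ : linSubst (MatIdx m) ℂ M (detFormLex ℂ m) = detFormLex ℂ m),
            LinearMap.ker ((MvPolynomial.aeval (R := ℂ) fun p : MatIdx m × MatIdx m =>
              ∑ l : MatIdx m, M l p.2 • MvPolynomial.X (p.1, l)).toLinearMap
              - LinearMap.id (R := ℂ) (M := MvPolynomial (MatIdx m × MatIdx m) ℂ)))
        ⊓ (⨅ (g : Matrix.GeneralLinearGroup (MatIdx m) ℂ) (_ : IsUpperTriangular g),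
            LinearMap.ker ((MvPolynomial.aeval (R := ℂ) fun p : MatIdx m × MatIdx m =>
              ∑ l : MatIdx m, ((g⁻¹ : Matrix.GeneralLinearGroup (MatIdx m) ℂ) :
                Matrix (MatIdx m) (MatIdx m) ℂ) p.1 l • MvPolynomial.X (l, p.2)).toLinearMap
              - weightChar χ g • LinearMap.id (R := ℂ) (M := MvPolynomial (MatIdx m × MatIdx m) ℂ)));
      T 2 = T 1) :=
  cutBites_trunc_two_eq_trunc_one_of_even m 2 ⟨m, by ring⟩ lam

end

end Summit.ValiantsHypothesis.ValiantsHypothesis.Theorems.CutBites.Negative
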